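import Summits.CriticalPhenomena.PercolationContinuityZ3.Theorems.PercNearOneGluingNoHeavyLowerTailAntitheticOSOne
import HarnessLib

/-!
# `NoHeavyLowerTail` (stmt-CriticalPhenomena-4575) — antithetic cluster pairs: LEMMA Λ_eq IS A PENDANT SUM (two markers; prim-hp-2 gen 45,
# HOME/THEOREM-OS-augmentation.md §6, HOME/THEOREM-Lambda-ears.md §0)

Support file (`--supports stmt-CriticalPhenomena-4575`, hull-port prover `prim-hp-2`, gen 45).  No definitions, no named facts, no sorries.

LEMMA Λ_eq (the `A⁺ = A` case of THEOREM Λ, with single-pair markers): for a pair set `E`, marker pairs `m_a = aℓ_a`, `m_b = bℓ_b` at fresh leaves and the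
pendant lifts `L_a, L_b` (`Pendant.liftSet`),  `Λ_eq := Σ_{ω ∈ tset_E(R,X)} [Δ(L_b C, L_a C′) + Δ(L_a L_b C, C′)]`  (`C, C′` the clusters of `s` on `E`).
* `Antithetic.LamEq.sum_eq_two_mul_tsum` — **`Λ_eq = 2 · T_{E ∪ {m_a, m_b}}(R, X)`** (`OSOne.sum_eq_tsum_insert` for `m_a` over `E ∪ {m_b}`, then the
  reflection `ω ↦ ω ∆ {m_b}` and the colour swap).
* `Antithetic.LamEq.nonneg_of_good` — hence `Λ_eq ≥ 0` whenever `E` is good for `(R, X)` (pendant-edge lemma twice): the lower LEVELS of the two-tail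
  reduction of CONJECTURE Δ2 (THEOREM-OS §6) are tree-theorem material on every good core.
[cite: VandenbergHaggstromKahn2005, §1 p. 3 (open cluster `C_s`)]
-/

noncomputable section

namespace Summit.CriticalPhenomena.PercolationContinuityZ3.Theorems

open Literature.Probability.Percolation
open scoped Classical symmDiff

namespace Antithetic

namespace LamEq

variable {V : Type*} [Fintype V] {E : Set (Sym2 V)} {s a b u ℓ ℓa ℓb : V}

/-- Half-sum principle: a summand that ignores the colour of a pendant pair `uℓ ∉ E` has equal sums over the `uℓ`-red and the `uℓ`-blue colourings
of the constraint set. [this work] -/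
theorem sum_filter_mem_eq (he : s(u, ℓ) ∉ E) (R X : Set V) (f : Set (Sym2 V) → ℝ) (hf : ∀ ω, f (ω ∆ {s(u, ℓ)}) = f ω) :
    ∑ ω ∈ (Peel.tset E s R X).filter (fun ω => s(u, ℓ) ∈ ω), f ω = ∑ ω ∈ (Peel.tset E s R X).filter (fun ω => ¬ s(u, ℓ) ∈ ω), f ω := by
  have hmem : ∀ ω, ω ∆ {s(u, ℓ)} ∈ Peel.tset E s R X ↔ ω ∈ Peel.tset E s R X := fun ω => by
    rw [Peel.mem_tset, Peel.mem_tset, Pendant.symmDiff_pair_inter he, Pendant.compl_symmDiff_pair_inter he]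
  refine Finset.sum_nbij' (fun ω => ω ∆ {s(u, ℓ)}) (fun ω => ω ∆ {s(u, ℓ)}) (fun ω hω => ?_) (fun ω hω => ?_)
    (fun ω _ => symmDiff_symmDiff_cancel_right _ _) (fun ω _ => symmDiff_symmDiff_cancel_right _ _) (fun ω _ => (hf ω).symm)
  · rw [Finset.mem_filter] at hω ⊢
    refine ⟨(hmem ω).2 hω.1, fun h => ?_⟩
    rw [Set.mem_symmDiff, Set.mem_singleton_iff] at h
    exact h.elim (fun h => h.2 rfl) (fun h => h.2 hω.2)
  · rw [Finset.mem_filter] at hω ⊢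
    refine ⟨(hmem ω).2 hω.1, ?_⟩
    rw [Set.mem_symmDiff, Set.mem_singleton_iff]
    exact Or.inr ⟨rfl, hω.2⟩

/-- Colour-swap principle: the sum of `g(ωᶜ)` over the `uℓ`-red colourings equals the sum of `g(ω)` over the `uℓ`-blue ones. [this work] -/
theorem sum_filter_compl_eq (R X : Set V) (g : Set (Sym2 V) → ℝ) :
    ∑ ω ∈ (Peel.tset E s R X).filter (fun ω => s(u, ℓ) ∈ ω), g ωᶜ = ∑ ω ∈ (Peel.tset E s R X).filter (fun ω => ¬ s(u, ℓ) ∈ ω), g ω := by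
  refine Finset.sum_nbij' (fun ω => ωᶜ) (fun ω => ωᶜ) (fun ω hω => ?_) (fun ω hω => ?_) (fun ω _ => compl_compl ω)
    (fun ω _ => compl_compl ω) (fun ω _ => rfl)
  · rw [Finset.mem_filter] at hω ⊢
    exact ⟨OSOne.compl_mem_tset hω.1, fun h => h hω.2⟩
  · rw [Finset.mem_filter] at hω ⊢
    exact ⟨OSOne.compl_mem_tset hω.1, Set.mem_compl hω.2⟩

/-- **`Λ_eq = 2 · T_{E ∪ {m_a, m_b}}`.** [this work] -/
theorem sum_eq_two_mul_tsum (hℓa : ∀ f ∈ E, ℓa ∈ f → f.IsDiag) (hℓb : ∀ f ∈ E, ℓb ∈ f → f.IsDiag) (haℓa : a ≠ ℓa) (hbℓb : b ≠ ℓb)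
    (hsℓa : s ≠ ℓa) (hsℓb : s ≠ ℓb) (hab : ℓa ≠ ℓb) (hbℓa : b ≠ ℓa) (R X : Set V) (hXa : ℓa ∉ X) (hXb : ℓb ∉ X) (F G : Set (Sym2 V) → ℝ) :
    ∑ ω ∈ Peel.tset E s R X,
        ((F (Pendant.liftSet s b s(b, ℓb) (openEdgeCluster (ω ∩ E) s)) - F (Pendant.liftSet s a s(a, ℓa) (openEdgeCluster (ωᶜ ∩ E) s))) *
            (G (Pendant.liftSet s b s(b, ℓb) (openEdgeCluster (ω ∩ E) s)) - G (Pendant.liftSet s a s(a, ℓa) (openEdgeCluster (ωᶜ ∩ E) s))) +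
          (F (Pendant.liftSet s a s(a, ℓa) (Pendant.liftSet s b s(b, ℓb) (openEdgeCluster (ω ∩ E) s))) - F (openEdgeCluster (ωᶜ ∩ E) s)) *
            (G (Pendant.liftSet s a s(a, ℓa) (Pendant.liftSet s b s(b, ℓb) (openEdgeCluster (ω ∩ E) s))) - G (openEdgeCluster (ωᶜ ∩ E) s))) =
      2 * Peel.tsum F G (insert s(a, ℓa) (insert s(b, ℓb) E)) s R X := by
  have heb : s(b, ℓb) ∉ E := Pendant.pair_not_mem E b ℓb hℓb hbℓb
  -- `ℓa` is still a fresh leaf of `E ∪ {m_b}`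
  have hℓa' : ∀ f ∈ insert s(b, ℓb) E, ℓa ∈ f → f.IsDiag := by
    intro f hf hℓ
    rcases Set.mem_insert_iff.1 hf with rfl | hf
    · rcases Sym2.mem_iff.1 hℓ with h | h
      · exact absurd h.symm hbℓa
      · exact absurd h hab
    · exact hℓa f hf hℓ
  rw [← OSOne.sum_eq_tsum_insert hℓa' haℓa hsℓa R X hXa F G, Pendant.tset_insert hℓb hbℓb hsℓb R X hXb]
  set S := Peel.tset E s R X with hS
  -- the four summands as functions of the colouring
  set T01 : Set (Sym2 V) → ℝ := fun ω =>
    (F (Pendant.liftSet s b s(b, ℓb) (openEdgeCluster (ω ∩ E) s)) - F (Pendant.liftSet s a s(a, ℓa) (openEdgeCluster (ωᶜ ∩ E) s))) *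
      (G (Pendant.liftSet s b s(b, ℓb) (openEdgeCluster (ω ∩ E) s)) - G (Pendant.liftSet s a s(a, ℓa) (openEdgeCluster (ωᶜ ∩ E) s))) with hT01
  set T11 : Set (Sym2 V) → ℝ := fun ω =>
    (F (Pendant.liftSet s a s(a, ℓa) (Pendant.liftSet s b s(b, ℓb) (openEdgeCluster (ω ∩ E) s))) - F (openEdgeCluster (ωᶜ ∩ E) s)) *
      (G (Pendant.liftSet s a s(a, ℓa) (Pendant.liftSet s b s(b, ℓb) (openEdgeCluster (ω ∩ E) s))) - G (openEdgeCluster (ωᶜ ∩ E) s)) with hT11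
  set T00 : Set (Sym2 V) → ℝ := fun ω =>
    (F (openEdgeCluster (ω ∩ E) s) - F (Pendant.liftSet s a s(a, ℓa) (Pendant.liftSet s b s(b, ℓb) (openEdgeCluster (ωᶜ ∩ E) s)))) *
      (G (openEdgeCluster (ω ∩ E) s) - G (Pendant.liftSet s a s(a, ℓa) (Pendant.liftSet s b s(b, ℓb) (openEdgeCluster (ωᶜ ∩ E) s)))) with hT00
  -- the `OS₁`-summand over `E ∪ {m_b}` in terms of the clusters on `E`
  have hterm : ∀ ω ∈ S,
      (F (openEdgeCluster (ω ∩ insert s(b, ℓb) E) s) - F (Pendant.liftSet s a s(a, ℓa) (openEdgeCluster (ωᶜ ∩ insert s(b, ℓb) E) s))) *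
          (G (openEdgeCluster (ω ∩ insert s(b, ℓb) E) s) - G (Pendant.liftSet s a s(a, ℓa) (openEdgeCluster (ωᶜ ∩ insert s(b, ℓb) E) s))) =
        if s(b, ℓb) ∈ ω then T01 ω else T00 ω := by
    intro ω _
    by_cases hb : s(b, ℓb) ∈ ω
    · have hbc : s(b, ℓb) ∉ ωᶜ := fun h => h hb
      rw [if_pos hb, Set.inter_insert_of_mem hb, Set.inter_insert_of_notMem hbc,
        Pendant.openEdgeCluster_insert s b ℓb (ω ∩ E) (fun f hf => hℓb f hf.2) hbℓb hsℓb]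
    · have hbc : s(b, ℓb) ∈ ωᶜ := hb
      rw [if_neg hb, Set.inter_insert_of_notMem hb, Set.inter_insert_of_mem hbc,
        Pendant.openEdgeCluster_insert s b ℓb (ωᶜ ∩ E) (fun f hf => hℓb f hf.2) hbℓb hsℓb]
  rw [Finset.sum_congr rfl hterm, Finset.sum_ite, Finset.sum_add_distrib]
  change ∑ ω ∈ S, T01 ω + ∑ ω ∈ S, T11 ω = 2 * (∑ ω ∈ S.filter (fun ω => s(b, ℓb) ∈ ω), T01 ω + ∑ ω ∈ S.filter (fun ω => ¬ s(b, ℓb) ∈ ω), T00 ω)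
  -- half-sum and swap principles
  have h01 := sum_filter_mem_eq (s := s) heb R X T01 (fun ω => by
    simp only [hT01, Pendant.symmDiff_pair_inter heb, Pendant.compl_symmDiff_pair_inter heb])
  have h11 := sum_filter_mem_eq (s := s) heb R X T11 (fun ω => by
    simp only [hT11, Pendant.symmDiff_pair_inter heb, Pendant.compl_symmDiff_pair_inter heb])
  have hsw := sum_filter_compl_eq (E := E) (s := s) (u := b) (ℓ := ℓb) R X T00
  have hsw' : ∑ ω ∈ S.filter (fun ω => s(b, ℓb) ∈ ω), T00 ωᶜ = ∑ ω ∈ S.filter (fun ω => s(b, ℓb) ∈ ω), T11 ω := by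
    refine Finset.sum_congr rfl fun ω _ => ?_
    simp only [hT00, hT11, compl_compl]
    ring
  have hs01 := Finset.sum_filter_add_sum_filter_not S (fun ω => s(b, ℓb) ∈ ω) T01
  have hs11 := Finset.sum_filter_add_sum_filter_not S (fun ω => s(b, ℓb) ∈ ω) T11
  simp only [hS] at hsw' hs01 hs11 ⊢
  linarith

/-- **`Λ_eq ≥ 0` on good pair sets.** [this work] -/
theorem nonneg_of_good (hℓa : ∀ f ∈ E, ℓa ∈ f → f.IsDiag) (hℓb : ∀ f ∈ E, ℓb ∈ f → f.IsDiag) (haℓa : a ≠ ℓa) (hbℓb : b ≠ ℓb)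
    (hsℓa : s ≠ ℓa) (hsℓb : s ≠ ℓb) (hab : ℓa ≠ ℓb) (hbℓa : b ≠ ℓa) (R X : Set V) (hXa : ℓa ∉ X) (hXb : ℓb ∉ X)
    (hgood : ∀ F G : Set (Sym2 V) → ℝ, Monotone F → Monotone G → 0 ≤ Peel.tsum F G E s R X)
    {F G : Set (Sym2 V) → ℝ} (hF : Monotone F) (hG : Monotone G) :
    0 ≤ ∑ ω ∈ Peel.tset E s R X,
        ((F (Pendant.liftSet s b s(b, ℓb) (openEdgeCluster (ω ∩ E) s)) - F (Pendant.liftSet s a s(a, ℓa) (openEdgeCluster (ωᶜ ∩ E) s))) *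
            (G (Pendant.liftSet s b s(b, ℓb) (openEdgeCluster (ω ∩ E) s)) - G (Pendant.liftSet s a s(a, ℓa) (openEdgeCluster (ωᶜ ∩ E) s))) +
          (F (Pendant.liftSet s a s(a, ℓa) (Pendant.liftSet s b s(b, ℓb) (openEdgeCluster (ω ∩ E) s))) - F (openEdgeCluster (ωᶜ ∩ E) s)) *
            (G (Pendant.liftSet s a s(a, ℓa) (Pendant.liftSet s b s(b, ℓb) (openEdgeCluster (ω ∩ E) s))) - G (openEdgeCluster (ωᶜ ∩ E) s))) := by
  have hℓa' : ∀ f ∈ insert s(b, ℓb) E, ℓa ∈ f → f.IsDiag := by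
    intro f hf hℓ
    rcases Set.mem_insert_iff.1 hf with rfl | hf
    · rcases Sym2.mem_iff.1 hℓ with h | h
      · exact absurd h.symm hbℓa
      · exact absurd h hab
    · exact hℓa f hf hℓ
  rw [sum_eq_two_mul_tsum hℓa hℓb haℓa hbℓb hsℓa hsℓb hab hbℓa R X hXa hXb F G]
  exact mul_nonneg zero_le_two
    (Pendant.good_insert hℓa' haℓa hsℓa R X hXa (fun F G hF hG => Pendant.good_insert hℓb hbℓb hsℓb R X hXb hgood hF hG) hF hG)

end LamEq

end Antithetic

end Summit.CriticalPhenomena.PercolationContinuityZ3.Theorems
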